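import Summits.BirchSwinnertonDyer.BirchSwinnertonDyer.Theorems.KimAtThreeD7uTamagawaTateUnramified
import HarnessLib

/-!
# The Tamagawa index AT THE TATE MODULE, II — the E-SPECIFIC order:
# `[H¹(ℚ_w, T_pE) : H¹_ur(ℚ_w, T_pE)] = #H¹(I_w, T_pE)^{Γ_{ℚ_w}} = p^{v_p(c_w)}` at every finite `w ∤ p`
# (cell `bsd-addord`, seat w2-tamdiv gen 8; route W2 `KimAtThreeKolyvagin`, items 19562 / 19560, «TamDiv∞»)

HONEST FRAMING: TOOL theorems (no definition, no named fact, no `sorry`); closes nothing by itself;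
nothing is booked; BSD is not proved by any of this.  Part XXVIII of the seat's series; part XXVII
(`KimAtThreeD7uTamagawaTateUnramified`) supplied `lim¹ = 0` and the surjective `red`-tower.  This file
proves the object every earlier hand named as NOT DONE — w2-acc5 g3 (`KimAtThreeDeepUpperOffStratumLocalIndex`:
«the E-SPECIFIC order `#H¹(I_w, T_pE)^{Fr} = (c_w)_p` is NOT here»), this seat's gen 3 (part III, the case
`p ∤ c_w` only) and gen 4 (part VII: the index at every FINITE level, «`T_pE`-level index … limit `k → ∞`
not written»):

**`index_unramifiedSubgroup_tate_eq_pow_padicValNat`** — for `W/ℚ` elliptic, ANY prime `p`, ANY finite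
place `w ∤ p` of ANY reduction type:
  `[H¹(ℚ_w, T_pE) : H¹_ur(ℚ_w, T_pE)] = p ^ v_p(c_w)`,
`c_w = [E(ℚ_w) : E₀(ℚ_w)]` the Tamagawa number of the minimal model (tree `localTamagawaNumber`),
`H¹_ur = GaloisRep.unramifiedSubgroup` (`= ker res_{I_w}`, gen 2).  Equivalently (acc5 g3's exact sequence
`0 → H¹_ur → H¹(ℚ_w, T_pE) → H¹(I_w, T_pE)^{Γ} → 0`): **`natCard_range_resSubgroup_absInertia_eq`**
(`#res_{I_w}(H¹(ℚ_w, T_pE)) = p^{v_p(c_w)}`) and **`natCard_invariants_inertiaCohomology_eq`**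
(`#H¹(I_w, T_pE)^{Γ_{ℚ_w}} = p^{v_p(c_w)}` — THE E-SPECIFIC ORDER), with the Frobenius form
`natCard_frobeniusInvariants_inertiaCohomology_eq` (`#H¹(I_w, T_pE)^{φ = 1}` for any arithmetic Frobenius
lift `φ`).  This is Rubin, *Euler Systems*, Lemma 1.3.5 (iii) with Prop. B.2.3 / Büyükboduk, JNT 129 (2009)
§2.1.2 Remark 2 («the order of `H⁰(ℚ_ℓ, W^{I_ℓ}/(W^{I_ℓ})_{div})` is the `p`-part of the Tamagawa number at
`ℓ`»): since `H¹(ℚ_w, V_pE) = 0` at `w ∤ p` (weights), `H¹_f(ℚ_w, T_pE) = H¹(ℚ_w, T_pE)` and the index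
`[H¹_f : H¹_ur]` of loc. cit. is the whole `[H¹ : H¹_ur]`.

PROOF.  `m := v_p(c_w)`, level `k := m` (so `p^m ∣ p^{k+1}`).  (1) `π_{k+1,*}⁻¹ 𝓕_u(w)_k = H¹_ur(ℚ_w, T_pE)`
(**`tateLocalMap_mem_blochKatoSelmerStructure_iff`**): if `π_{k+1,*} y ∈ 𝓕_u(w)_k = π_{k+1,*} H¹_ur` then,
correcting `y` by an unramified class, `π_{k+1,*} y = 0`; every other reduction `π_{j+1,*} y` then lies in
`𝓕_u(w)_j` — for `j ≤ k` it is `red_*(0) = 0`, for `j > k` it lies in `𝓕_can(w)_j ∩ red_*⁻¹ 𝓕_u(w)_k`, and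
`red_* : 𝓕_can(w)_j ↠ 𝓕_can(w)_k` maps `𝓕_u(w)_j ↠ 𝓕_u(w)_k` (part XXVII) with EQUAL indices `p^m`
(part VII cor. §3), so that intersection IS `𝓕_u(w)_j` (§0, an index count); hence all reductions are
unramified and `y ∈ H¹_ur` by part XXVII's `lim¹ = 0`.  (2) So `π_{k+1,*}` induces an injection
`H¹/H¹_ur ↪ H¹(ℚ_w, E[p^k · p])/𝓕_u(w)_k` with image `𝓕_can(w)_k/𝓕_u(w)_k`, of order `p^m` (part VII).

Corollaries: `unramifiedSubgroup_tate_eq_top_iff` (`H¹_ur = H¹ ↔ p ∤ c_w`: gen 3's part III and its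
converse), `finite_quotient_unramifiedSubgroup_tate`, `exists_resSubgroup_absInertia_ne_zero_of_dvd`
(`p ∣ c_w ⇒` a RAMIFIED class of `H¹(ℚ_w, T_pE)` exists).

References: K. Rubin, *Euler Systems* (2000) Lemma 1.3.2, Lemma 1.3.5, Prop. B.2.3; K. Büyükboduk, JNT 129
(2009) §2.1.2 Remark 2, Thm. 3.1; B. Mazur, K. Rubin, Mem. AMS 799 (2004) Prop. 6.2.6, App. A Remark A.5;
A. Grothendieck, SGA 7 I, Exp. IX §11; J. S. Milne, *ADT* I Prop. 3.8, Remark 3.10.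
-/

noncomputable section

-- the cell's Theorems namespace `Summit.BirchSwinnertonDyer.BirchSwinnertonDyer.…` repeats the summit name by design (D-0017)
set_option linter.dupNamespace false

open CategoryTheory Function Field IsDedekindDomain NumberField
open scoped NumberField Classical ContRepresentation
open Literature.NumberTheory.GaloisRepresentations Literature.NumberTheory.EllipticCurves
open Literature.NumberTheory.GaloisRepresentations.IsNonarchimedeanLocalField
open Literature.NumberTheory.GaloisCohomology
open WeierstrassCurve
open Summit.BirchSwinnertonDyer.Rank1Residual.GaloisImage
open Summit.BirchSwinnertonDyer.Rank1Residual.X11b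
open Summit.BirchSwinnertonDyer.BirchSwinnertonDyer.Theorems.KimAtThreeDeepUpperOffStratumLocalIndex
open Summit.BirchSwinnertonDyer.BirchSwinnertonDyer.Theorems.KimAtThreeD7uBlochKatoCondition
open Summit.BirchSwinnertonDyer.BirchSwinnertonDyer.Theorems.KimAtThreeD7uTamagawaTateUnramified

namespace Summit.BirchSwinnertonDyer.BirchSwinnertonDyer.Theorems.KimAtThreeD7uTamagawaTateIndex

/-! ### §0 An index count: equal indices along a surjection force the preimage -/

/-- **Equal indices along a surjection.**  `f : G → G'` a homomorphism, `S ≤ A ≤ G` with `A` finite,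
`S' ≤ G'` with `f(A) = A'`, `f(S) ≤ S'` and `[A : S] = [A' : S']`: then `A ∩ f⁻¹(S') = S`, i.e. an element of
`A` mapping into `S'` lies in `S` (the preimage `A ∩ f⁻¹ S' ⊇ S` has index `[A' : S'] = [A : S]` in `A`). [folklore] -/
theorem mem_of_mem_of_map_mem_of_relIndex_eq {G G' : Type*} [AddCommGroup G] [AddCommGroup G']
    (f : G →+ G') {A S : AddSubgroup G} {A' S' : AddSubgroup G'} [Finite A]
    (hSA : S ≤ A) (hA : A.map f = A') (hS : S.map f ≤ S') (hidx : S.relIndex A = S'.relIndex A')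
    {x : G} (hx : x ∈ A) (hfx : f x ∈ S') : x ∈ S := by
  -- `K₀ := f⁻¹ S' ⊓ A`, `S ≤ K₀ ≤ A`
  have hSK : S ≤ S'.comap f ⊓ A :=
    le_inf ((AddSubgroup.le_comap_map f S).trans (AddSubgroup.comap_mono hS)) hSA
  have hKA : S'.comap f ⊓ A ≤ A := inf_le_right
  -- `[A : K₀] = [A' : S']`
  have hK : (S'.comap f ⊓ A).relIndex A = S'.relIndex A' := by
    rw [AddSubgroup.inf_relIndex_right, AddSubgroup.relIndex_comap, hA]
  -- `[K₀ : S] · [A : K₀] = [A : S]`, all finite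
  have hmul := AddSubgroup.relIndex_mul_relIndex _ _ _ hSK hKA
  rw [hK, ← hidx] at hmul
  have hne : S.relIndex A ≠ 0 := by
    rw [AddSubgroup.relIndex]
    exact AddSubgroup.index_ne_zero_of_finite
  have hone : S.relIndex (S'.comap f ⊓ A) = 1 := by
    have h : S.relIndex (S'.comap f ⊓ A) * S.relIndex A = 1 * S.relIndex A := by rw [hmul, one_mul]
    exact Nat.eq_of_mul_eq_mul_right (Nat.pos_of_ne_zero hne) h
  rw [AddSubgroup.relIndex_eq_one] at hone
  exact hone ⟨hfx, hx⟩

variable (W : WeierstrassCurve ℚ) [W.IsElliptic] (p : ℕ) [hp : Fact p.Prime]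
  (w : HeightOneSpectrum (𝓞 ℚ))

/-- Local notation: `T_pE|_{Γ_{ℚ_w}}` (= `tateLocalRep W p (Sum.inr w)`, by `rfl`). -/
local notation3 "𝕋" => (GaloisRep.restrictField (HeightOneSpectrum.adicCompletion ℚ w)
  (WeierstrassCurve.tateGaloisRep W p (W.continuous_galoisRepTate_holds p)).toIntRep)
/-- Local notation: the image `π_{k+1,*} H¹_ur(ℚ_w, T_pE)` (= `𝓕_u(w)_k` at `w ∤ p`, part XXVII). -/
local notation3 "𝔉ᵤ[" k "]" => AddSubgroup.map (tateLocalMap W p k (Sum.inr w))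
  (GaloisRep.unramifiedSubgroup (GaloisRep.restrictField (HeightOneSpectrum.adicCompletion ℚ w)
    (WeierstrassCurve.tateGaloisRep W p (W.continuous_galoisRepTate_holds p)).toIntRep) 1)
/-- Local notation: the Tamagawa number `c_w` of the minimal model at `w`. -/
local notation3 "𝔠" => (WeierstrassCurve.baseChange W (HeightOneSpectrum.adicCompletion ℚ w)).localTamagawaNumber
  (HeightOneSpectrum.adicCompletionIntegers ℚ w)

/-! ### §1 The relative index `[𝓕_can(w)_k : 𝓕_u(w)_k] = p^{v_p(c_w)}` at deep levels (part VII, re-keyed) -/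

/-- `[𝓕_can(w)_k : π_{k+1,*} H¹_ur] = p^{v_p(c_w)}` at a level `k` with `p^{v_p(c_w)} ∣ p^{k+1}` (part VII cor. §3,
as a relative index). [cite: Rubin2000, Lemma 1.3.5] [cite: MazurRubin2004, Prop. 6.2.6 (p. 75) and App. A Remark A.5 (p. 81)] -/
theorem relIndex_map_unramifiedSubgroup_propagatedSelmerStructure_eq (k : ℕ)
    (hw : ((p : ℕ) : 𝓞 ℚ) ∉ w.asIdeal) (hk : p ^ padicValNat p 𝔠 ∣ p ^ (k + 1)) :
    (𝔉ᵤ[k]).relIndex (propagatedSelmerStructure W p k (Sum.inr w)) = p ^ padicValNat p 𝔠 := by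
  have hcard := natCard_propagatedSelmerStructure_eq_natCard_map_mul W p w k hw hk
  -- `#S · [A : S] = #A` (tree `JET.Section6.card_mul_relIndex_of_le`, re-derived in two lines to keep the imports local)
  have hmul := AddSubgroup.relIndex_mul_relIndex _ _ _ bot_le
    (map_unramifiedSubgroup_le_propagatedSelmerStructure W p w k)
  rw [AddSubgroup.relIndex_bot_left, AddSubgroup.relIndex_bot_left] at hmul
  exact Nat.eq_of_mul_eq_mul_left (Nat.pos_of_ne_zero (natCard_map_unramifiedSubgroup_ne_zero W p w k hw))
    (hmul.trans hcard)

/-- The same in named currency: `[𝓕_can(w)_k : 𝓕_u(w)_k] = p^{v_p(c_w)}` (`𝓕_u = blochKatoSelmerStructure`).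
[cite: Rubin2000, Lemma 1.3.5] [cite: MazurRubin2004, Prop. 6.2.6 (p. 75) and App. A Remark A.5 (p. 81)] -/
theorem relIndex_blochKatoSelmerStructure_propagatedSelmerStructure_eq (k : ℕ)
    (L : (tateTorsionDatum W p k).LocalConditionsAbove p) (hw : ((p : ℕ) : 𝓞 ℚ) ∉ w.asIdeal)
    (hk : p ^ padicValNat p 𝔠 ∣ p ^ (k + 1)) :
    (blochKatoSelmerStructure p (tateTorsionDatum W p k) L (Sum.inr w)).relIndex
        (propagatedSelmerStructure W p k (Sum.inr w)) = p ^ padicValNat p 𝔠 := by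
  rw [blochKatoSelmerStructure_inr_eq_map W p w k L hw]
  exact relIndex_map_unramifiedSubgroup_propagatedSelmerStructure_eq W p w k hw hk

/-! ### §2 `π_{k+1,*}⁻¹ 𝓕_u(w)_k = H¹_ur(ℚ_w, T_pE)` at deep levels -/

/-- **A `T_pE`-class whose reduction at ONE deep level is the reduction of an unramified class IS unramified**:
at a finite `w ∤ p` and a level `k` with `p^{v_p(c_w)} ∣ p^{k+1}`, for `y ∈ H¹(ℚ_w, T_pE)`,
`π_{k+1,*} y ∈ π_{k+1,*} H¹_ur ↔ y ∈ H¹_ur(ℚ_w, T_pE)` (see the module docstring, step (1): correction by an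
unramified class, the `red`-tower with equal indices past the threshold, §0, and part XXVII's `lim¹ = 0`).
[cite: Rubin2000, Lemma 1.3.5 and App. B Prop. B.2.3] [cite: MazurRubin2004, App. A Remark A.5 (p. 81)] -/
theorem tateLocalMap_mem_map_unramifiedSubgroup_iff (k : ℕ) (hw : ((p : ℕ) : 𝓞 ℚ) ∉ w.asIdeal)
    (hk : p ^ padicValNat p 𝔠 ∣ p ^ (k + 1)) (y : (tateLocalRep W p (Sum.inr w)).cohomology 1) :
    tateLocalMap W p k (Sum.inr w) y ∈ 𝔉ᵤ[k] ↔ y ∈ GaloisRep.unramifiedSubgroup (𝕋) 1 := by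
  refine ⟨fun hy => ?_, fun hy => AddSubgroup.mem_map_of_mem _ hy⟩
  -- correct `y` by an unramified class `u` with `π_{k+1,*} u = π_{k+1,*} y`
  obtain ⟨u, hu, huy⟩ := AddSubgroup.mem_map.mp hy
  suffices h : y - u ∈ GaloisRep.unramifiedSubgroup (𝕋) 1 from
    (congrArg (· ∈ GaloisRep.unramifiedSubgroup (𝕋) 1) (sub_add_cancel y u)).mp (add_mem h hu)
  have h0 : tateLocalMap W p k (Sum.inr w) (y - u) = 0 := by rw [map_sub, huy, sub_self]
  -- every reduction of `y - u` lies in `π_{j+1,*} H¹_ur`, hence is unramified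
  refine (mem_unramifiedSubgroup_tate_iff_forall W p w (y - u)).mpr fun j => ?_
  suffices hj : tateLocalMap W p j (Sum.inr w) (y - u) ∈ 𝔉ᵤ[j] by
    obtain ⟨u', hu', hu'eq⟩ := AddSubgroup.mem_map.mp hj
    rw [← hu'eq]
    exact tateLocalMap_mem_unramifiedSubgroup_of_mem W p w j hu'
  rcases le_or_gt j k with hjk | hjk
  · -- `j ≤ k`: `π_{j+1,*}(y-u) = red_* π_{k+1,*}(y-u) = 0`
    obtain ⟨red, hred⟩ := exists_torsionReduction_pow_mul W p j k
    rw [← localMap_red_tateLocalMap_apply W p hjk red hred (Sum.inr w), h0, map_zero]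
    exact zero_mem _
  · -- `j > k`: `π_{j+1,*}(y-u) ∈ 𝓕_can(w)_j ∩ red_*⁻¹ π_{k+1,*} H¹_ur = π_{j+1,*} H¹_ur` (equal indices `p^m`)
    obtain ⟨red, hred⟩ := exists_torsionReduction_pow_mul W p k j
    have hkj : k ≤ j := hjk.le
    have hj : p ^ padicValNat p 𝔠 ∣ p ^ (j + 1) := hk.trans (pow_dvd_pow p (by omega))
    haveI := KimAtThreeD7uTamagawaIndex.finite_propagatedSelmerStructure_inr W p j w hw
    refine mem_of_mem_of_map_mem_of_relIndex_eq (DiscreteGaloisModule.localMap red (Sum.inr w))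
      (map_unramifiedSubgroup_le_propagatedSelmerStructure W p w j)
      (map_localMap_red_propagatedSelmerStructure W p hkj red hred (Sum.inr w))
      (map_localMap_red_map_unramifiedSubgroup W p w hkj red hred).le ?_ ?_ ?_
    · rw [relIndex_map_unramifiedSubgroup_propagatedSelmerStructure_eq W p w j hw hj,
        relIndex_map_unramifiedSubgroup_propagatedSelmerStructure_eq W p w k hw hk]
    · exact (mem_propagatedSelmerStructure_iff W p j (Sum.inr w) _).mpr ⟨_, rfl⟩
    · rw [localMap_red_tateLocalMap_apply W p hkj red hred (Sum.inr w), h0]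
      exact zero_mem _

/-- **`π_{k+1,*} y ∈ 𝓕_u(w)_k ↔ y ∈ H¹_ur(ℚ_w, T_pE)`** at deep levels, in named currency
(`𝓕_u(w)_k = blochKatoSelmerStructure p (tateTorsionDatum W p k) L (Sum.inr w)`, [MR04] Remark A.5's condition).
[cite: Rubin2000, Lemma 1.3.5 and App. B Prop. B.2.3] [cite: MazurRubin2004, App. A Remark A.5 (p. 81)] -/
theorem tateLocalMap_mem_blochKatoSelmerStructure_iff (k : ℕ)
    (L : (tateTorsionDatum W p k).LocalConditionsAbove p) (hw : ((p : ℕ) : 𝓞 ℚ) ∉ w.asIdeal)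
    (hk : p ^ padicValNat p 𝔠 ∣ p ^ (k + 1)) (y : (tateLocalRep W p (Sum.inr w)).cohomology 1) :
    tateLocalMap W p k (Sum.inr w) y ∈ blochKatoSelmerStructure p (tateTorsionDatum W p k) L (Sum.inr w) ↔
      y ∈ GaloisRep.unramifiedSubgroup (𝕋) 1 := by
  rw [blochKatoSelmerStructure_inr_eq_map W p w k L hw]
  exact tateLocalMap_mem_map_unramifiedSubgroup_iff W p w k hw hk y

/-- The same as an equality of subgroups: `π_{k+1,*}⁻¹ 𝓕_u(w)_k = H¹_ur(ℚ_w, T_pE)` at deep levels. [cite: Rubin2000, Lemma 1.3.5] -/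
theorem comap_tateLocalMap_blochKatoSelmerStructure_eq (k : ℕ)
    (L : (tateTorsionDatum W p k).LocalConditionsAbove p) (hw : ((p : ℕ) : 𝓞 ℚ) ∉ w.asIdeal)
    (hk : p ^ padicValNat p 𝔠 ∣ p ^ (k + 1)) :
    (blochKatoSelmerStructure p (tateTorsionDatum W p k) L (Sum.inr w)).comap (tateLocalMap W p k (Sum.inr w)) =
      GaloisRep.unramifiedSubgroup (𝕋) 1 := by
  ext y
  exact tateLocalMap_mem_blochKatoSelmerStructure_iff W p w k L hw hk y

/-! ### §3 THE INDEX `[H¹(ℚ_w, T_pE) : H¹_ur(ℚ_w, T_pE)] = p^{v_p(c_w)}` -/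

/-- **The Tamagawa index at the Tate module** (Rubin, *Euler Systems*, Lemma 1.3.5 (iii) + Prop. B.2.3;
Büyükboduk 2009 §2.1.2 Remark 2; the `T_pE`-level form of [MR04] Prop. 6.2.6's local sentence): for `W/ℚ`
elliptic, ANY prime `p` and ANY finite place `w ∤ p` of ANY reduction type,
`[H¹(ℚ_w, T_pE) : H¹_ur(ℚ_w, T_pE)] = p ^ v_p(c_w)` (`c_w` the Tamagawa number of the minimal model).
See the module docstring for the proof. [cite: Rubin2000, Lemma 1.3.5 and App. B Prop. B.2.3]
[cite: MazurRubin2004, Prop. 6.2.6 (p. 75) and App. A Remark A.5 (p. 81)] -/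
theorem index_unramifiedSubgroup_tate_eq_pow_padicValNat (hw : ((p : ℕ) : 𝓞 ℚ) ∉ w.asIdeal) :
    (GaloisRep.unramifiedSubgroup (𝕋) 1).index = p ^ padicValNat p 𝔠 := by
  have hk : p ^ padicValNat p 𝔠 ∣ p ^ (padicValNat p 𝔠 + 1) := pow_dvd_pow p (Nat.le_succ _)
  -- `f = (mod π_{k+1,*} H¹_ur) ∘ π_{k+1,*}` at the level `k = v_p(c_w)`: `ker f = H¹_ur`, `range f = 𝓕_can/𝓕_u`
  let f := (QuotientAddGroup.mk' (𝔉ᵤ[padicValNat p 𝔠])).comp (tateLocalMap W p (padicValNat p 𝔠) (Sum.inr w))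
  have hker : f.ker = GaloisRep.unramifiedSubgroup (𝕋) 1 := by
    ext y
    rw [AddMonoidHom.mem_ker, AddMonoidHom.coe_comp, Function.comp_apply, QuotientAddGroup.mk'_apply,
      QuotientAddGroup.eq_zero_iff]
    exact tateLocalMap_mem_map_unramifiedSubgroup_iff W p w _ hw hk y
  have hrange : f.range = (propagatedSelmerStructure W p (padicValNat p 𝔠) (Sum.inr w)).map
      (QuotientAddGroup.mk' (𝔉ᵤ[padicValNat p 𝔠])) := by
    rw [propagatedSelmerStructure_eq_range, AddMonoidHom.map_range]
  calc (GaloisRep.unramifiedSubgroup (𝕋) 1).index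
      = f.ker.index := (congrArg AddSubgroup.index hker).symm
    _ = Nat.card f.range := AddSubgroup.index_ker f
    _ = Nat.card ((propagatedSelmerStructure W p (padicValNat p 𝔠) (Sum.inr w)).map
          (QuotientAddGroup.mk' (𝔉ᵤ[padicValNat p 𝔠]))) := by rw [hrange]
    _ = (𝔉ᵤ[padicValNat p 𝔠]).relIndex (propagatedSelmerStructure W p (padicValNat p 𝔠) (Sum.inr w)) := by
          rw [← AddSubgroup.relIndex_ker, QuotientAddGroup.ker_mk']
    _ = p ^ padicValNat p 𝔠 :=
          relIndex_map_unramifiedSubgroup_propagatedSelmerStructure_eq W p w _ hw hk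

/-- The same as a cardinality: `#(H¹(ℚ_w, T_pE) ⧸ H¹_ur(ℚ_w, T_pE)) = p ^ v_p(c_w)`. [cite: Rubin2000, Lemma 1.3.5] -/
theorem natCard_quotient_unramifiedSubgroup_tate_eq (hw : ((p : ℕ) : 𝓞 ℚ) ∉ w.asIdeal) :
    Nat.card ((𝕋).cohomology 1 ⧸ GaloisRep.unramifiedSubgroup (𝕋) 1) = p ^ padicValNat p 𝔠 :=
  index_unramifiedSubgroup_tate_eq_pow_padicValNat W p w hw

/-! ### §4 The E-SPECIFIC ORDER `#H¹(I_w, T_pE)^{Γ_{ℚ_w}} = p^{v_p(c_w)}` and corollaries -/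

/-- **`#res_{I_w}(H¹(ℚ_w, T_pE)) = p^{v_p(c_w)}`**: the image of the restriction to inertia
`H¹(ℚ_w, T_pE) → H¹(I_w, T_pE)` has exactly `p^{v_p(c_w)}` elements (`H¹_ur = ker res_{I_w}`, gen 2, and §3).
[cite: Rubin2000, Lemma 1.3.2 and Lemma 1.3.5] -/
theorem natCard_range_resSubgroup_absInertia_eq (hw : ((p : ℕ) : 𝓞 ℚ) ∉ w.asIdeal) :
    Nat.card (Set.range fun y : (𝕋).cohomology 1 =>
      resSubgroup (𝕋).toTopRep (absInertia (w.adicCompletion ℚ)) 1 y) = p ^ padicValNat p 𝔠 := by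
  let r : (𝕋).cohomology 1 →+
      continuousCohomology 1 (subgroupRep (𝕋).toTopRep (absInertia (w.adicCompletion ℚ))) :=
    (resSubgroup (𝕋).toTopRep (absInertia (w.adicCompletion ℚ)) 1).hom.toLinearMap.toAddMonoidHom
  have hr : ∀ y, r y = resSubgroup (𝕋).toTopRep (absInertia (w.adicCompletion ℚ)) 1 y := fun _ => rfl
  have hker : r.ker = GaloisRep.unramifiedSubgroup (𝕋) 1 := by
    ext y
    rw [AddMonoidHom.mem_ker, hr]
    exact (mem_unramifiedSubgroup_iff_resSubgroup_absInertia_eq_zero W p w y).symm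
  have h := AddSubgroup.index_ker r
  rw [hker, index_unramifiedSubgroup_tate_eq_pow_padicValNat W p w hw] at h
  rw [h]
  exact Nat.card_congr (Equiv.subtypeEquivRight fun x => Iff.rfl)

/-- **THE E-SPECIFIC ORDER `#H¹(I_w, T_pE)^{Γ_{ℚ_w}} = p^{v_p(c_w)}`** (Rubin, *Euler Systems*, Lemma 1.3.5 (iii)
with Prop. B.2.3; Büyükboduk 2009 §2.1.2 Remark 2: «the order of `H⁰(ℚ_ℓ, W^{I_ℓ}/(W^{I_ℓ})_{div})` is the
`p`-part of the Tamagawa number at `ℓ`»): for `W/ℚ` elliptic, ANY prime `p` and ANY finite place `w ∤ p` of ANY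
reduction type, the classes of `H¹(I_w, T_pE)` invariant under `Γ_{ℚ_w}` (conjugation action; `I_w` acts
trivially, so these are the `Gal(ℚ_w^{nr}/ℚ_w)`-invariants) number exactly `p^{v_p(c_w)}` — they are the
restrictions (acc5 g3 `exists_resSubgroup_inertia_eq_iff_forall_conjMap_eq`, `cd Ẑ = 1`) and §3 counts those.
This is the right end of acc5 g3's `0 → H¹_ur(ℚ_w, T_pE) → H¹(ℚ_w, T_pE) → H¹(I_w, T_pE)^{Γ} → 0` made
numerical: the order it named as «NOT here». [cite: Rubin2000, Lemma 1.3.2, Lemma 1.3.5 and App. B Prop. B.2.3]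
[cite: MazurRubin2004, Prop. 6.2.6 (p. 75) and App. A Remark A.5 (p. 81)] -/
theorem natCard_invariants_inertiaCohomology_eq (hw : ((p : ℕ) : 𝓞 ℚ) ∉ w.asIdeal) :
    Nat.card {yc : continuousCohomology 1 (subgroupRep (𝕋).toTopRep (absInertia (w.adicCompletion ℚ))) //
      ∀ g : absoluteGaloisGroup (w.adicCompletion ℚ),
        haveI : (absInertia (w.adicCompletion ℚ)).Normal := absInertia_normal_holds _
        conjMap (𝕋).toTopRep (absInertia (w.adicCompletion ℚ)) g 1 yc = yc} = p ^ padicValNat p 𝔠 := by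
  rw [← natCard_range_resSubgroup_absInertia_eq W p w hw]
  refine Nat.card_congr (Equiv.subtypeEquivRight fun yc => ?_)
  rw [Set.mem_range]
  exact (exists_resSubgroup_inertia_eq_iff_forall_conjMap_eq W p w yc).symm

/-- **Frobenius form: `#H¹(I_w, T_pE)^{φ = 1} = p^{v_p(c_w)}`** for any arithmetic Frobenius lift `φ ∈ Γ_{ℚ_w}`
(`IsFrobPow φ 1`): a `φ`-invariant class is already a restriction (acc5 g3
`exists_resSubgroup_inertia_eq_of_conjMap_eq`), hence `Γ_{ℚ_w}`-invariant.
[cite: Rubin2000, Lemma 1.3.2, Lemma 1.3.5 and App. B Prop. B.2.3] -/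
theorem natCard_frobeniusInvariants_inertiaCohomology_eq (hw : ((p : ℕ) : 𝓞 ℚ) ∉ w.asIdeal)
    {φ : absoluteGaloisGroup (w.adicCompletion ℚ)} (hφ : IsFrobPow φ 1) :
    Nat.card {yc : continuousCohomology 1 (subgroupRep (𝕋).toTopRep (absInertia (w.adicCompletion ℚ))) //
        haveI : (absInertia (w.adicCompletion ℚ)).Normal := absInertia_normal_holds _
        conjMap (𝕋).toTopRep (absInertia (w.adicCompletion ℚ)) φ 1 yc = yc} = p ^ padicValNat p 𝔠 := by
  rw [← natCard_range_resSubgroup_absInertia_eq W p w hw]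
  refine Nat.card_congr (Equiv.subtypeEquivRight fun yc => ?_)
  rw [Set.mem_range]
  constructor
  · intro h
    obtain ⟨xc, hxc⟩ := exists_resSubgroup_inertia_eq_of_conjMap_eq W p w hφ yc h
    exact ⟨xc, hxc⟩
  · rintro ⟨xc, hxc⟩
    exact (exists_resSubgroup_inertia_eq_iff_forall_conjMap_eq W p w yc).mp ⟨xc, hxc⟩ φ

/-- `H¹(ℚ_w, T_pE)/H¹_ur(ℚ_w, T_pE)` is finite at `w ∤ p` (index `p^{v_p(c_w)} ≠ 0`). [cite: Rubin2000, Lemma 1.3.5] -/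
theorem finite_quotient_unramifiedSubgroup_tate (hw : ((p : ℕ) : 𝓞 ℚ) ∉ w.asIdeal) :
    Finite ((𝕋).cohomology 1 ⧸ GaloisRep.unramifiedSubgroup (𝕋) 1) := by
  have h : (GaloisRep.unramifiedSubgroup (𝕋) 1).index ≠ 0 := by
    rw [index_unramifiedSubgroup_tate_eq_pow_padicValNat W p w hw]
    exact pow_ne_zero _ hp.out.ne_zero
  exact (AddSubgroup.fintypeOfIndexNeZero h).finite

/-- **The places of Tamagawa defect at the Tate module: `H¹_ur(ℚ_w, T_pE) = H¹(ℚ_w, T_pE) ↔ p ∤ c_w`** — gen 3's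
part III (`unramifiedSubgroup_tate_eq_top_of_not_dvd_localTamagawaNumber`, the direction `←`) and its converse:
when `p ∣ c_w` some class of `H¹(ℚ_w, T_pE)` is RAMIFIED.  [cite: Rubin2000, Lemma 1.3.5]
[cite: MazurRubin2004, Prop. 6.2.6 (p. 75) and App. A Remark A.5 (p. 81)] -/
theorem unramifiedSubgroup_tate_eq_top_iff (hw : ((p : ℕ) : 𝓞 ℚ) ∉ w.asIdeal) :
    GaloisRep.unramifiedSubgroup (𝕋) 1 = ⊤ ↔ ¬ p ∣ 𝔠 := by
  rw [← AddSubgroup.index_eq_one, index_unramifiedSubgroup_tate_eq_pow_padicValNat W p w hw,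
    Nat.pow_eq_one, padicValNat.eq_zero_iff]
  have hc : 𝔠 ≠ 0 := W.localTamagawaNumber_baseChange_ne_zero w
  have hp1 : p ≠ 1 := hp.out.ne_one
  constructor
  · rintro (h | h | h | h)
    · exact absurd h hp1
    · exact absurd h hp1
    · exact absurd h hc
    · exact h
  · exact fun h => Or.inr (Or.inr (Or.inr h))

/-- **`p ∣ c_w ⇒` a ramified class of `H¹(ℚ_w, T_pE)` exists**: some `y ∈ H¹(ℚ_w, T_pE)` has `res_{I_w} y ≠ 0`
(the converse of part III at the Tate module). [cite: Rubin2000, Lemma 1.3.5]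
[cite: MazurRubin2004, Prop. 6.2.6 (p. 75) and App. A Remark A.5 (p. 81)] -/
theorem exists_resSubgroup_absInertia_ne_zero_of_dvd (hw : ((p : ℕ) : 𝓞 ℚ) ∉ w.asIdeal) (hc : p ∣ 𝔠) :
    ∃ y : (𝕋).cohomology 1, resSubgroup (𝕋).toTopRep (absInertia (w.adicCompletion ℚ)) 1 y ≠ 0 := by
  by_contra h
  have h' : ∀ y : (𝕋).cohomology 1,
      resSubgroup (𝕋).toTopRep (absInertia (w.adicCompletion ℚ)) 1 y = 0 :=
    fun y => by_contra fun hy => h ⟨y, hy⟩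
  have htop : GaloisRep.unramifiedSubgroup (𝕋) 1 = ⊤ := by
    rw [eq_top_iff]
    intro y _
    exact (mem_unramifiedSubgroup_iff_resSubgroup_absInertia_eq_zero W p w y).mpr (h' y)
  exact (unramifiedSubgroup_tate_eq_top_iff W p w hw).mp htop hc

end Summit.BirchSwinnertonDyer.BirchSwinnertonDyer.Theorems.KimAtThreeD7uTamagawaTateIndex

end
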